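import Literature.MathematicalPhysics.QuantumFieldTheory.Balaban1983to89.B16RatioResummationProps

/-!
# `Balaban1983to89.B16RatioResummationBound` — the (1.97)-type ACTIVITY BOUND for the hole-anchored activities of
# `B16RatioResummation`: «one small factor per covered marked point, exponential decay in the size of the footprint»

Fifth file of the group (`…Defs`, `…Items`, `B16RatioResummation`, `…Props`, this file).  Print, [Balaban1989LargeFieldII] (1.97) p. 389:
*"|F(X′)| ≤ … exp(−p₀(g_k)) … exp(−κ d_k(X′))"* — the activities of the resummed gas inherit one small factor per large-field
region and the tree decay of their footprint; [Dimock2013BalabanII] (sunshine): `|H^#(Y)| ≤ O(1) H₀ e^{−(κ − 3κ₀ − 3) d_M(Y)}`.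

THE STATEMENT (`norm_holeAct_le`).  Data: a sub-additive SIZE `sz ≥ 0` of subsets (`sz ∅ = 0`), small factors `0 ≤ sf b ≤ 1` at the marked
points, hole activities with `‖h X‖ ≤ (Π_{b ∈ Q ∩ X} sf b)·e^{−κ_h·sz X}` on admissible `X` (each containing a marked point), vacuum activities
satisfying the global Kotecký–Preiss condition (1) with size functions `a, d ≥ 0` such that `a X ≤ τ·sz X` on admissible `X`, `κ′·sz γ ≤ d γ` and
`a γ·e^{−d γ} ≤ A₀` on the catalogue, and the pinned entropy bound `Σ_{X adm ∋ b} e^{−(κ_h − κ′ − e^{A₀}τ)·sz X} ≤ ε` at every marked point.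
Conclusion: **`‖holeAct adm Λ Q h v Y‖ ≤ (Π_{b ∈ Q ∩ Y} sf b·e^{ε}) · e^{−κ′·sz Y}`** for EVERY `Y`.

PROOF ROUTE (as in print ∕ Dimock App. B step 4, with [KoteckyPreiss1986] (4) for the cluster sums).  (i) Per term: `sz Y ≤ Σ sz X + Σ_C Σ_{γ∈C}
sz γ` on a term with footprint `Y` (`sz_fp_le`, previous file), so `e^{κ′ sz Y}` is distributed over the items; (ii) the Mayer factors: `‖e^{−Φ^T(C)} − 1‖ ≤
‖Φ^T(C)‖·e^{A₀}` since `‖Φ^T(C)‖ ≤ a(γ₀)e^{−d(γ₀)} ≤ A₀` for `γ₀ ∈ C` by (4) (`norm_truncatedWeight_le_of_mem`, previous file); (iii) the sum over the attached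
cluster families is `Π(1 + ·) ≤ exp Σ`, and `Σ_{C ι X} ‖Φ^T(C)‖e^{d(C)} ≤ a(X) ≤ τ·sz X` by (4) (`LatticeModels.sum_norm_truncatedWeight_mul_exp_le_of_touches`);
(iv) the covering clause turns `Π_X Π_{b∈Q∩X} sf b` into `Π_{b ∈ Q∩Y} sf b`; (v) the sum over admissible hole families inside `Y` is `≤ exp(Σ_{X adm ⊆ Y}
e^{−κ″ sz X}) ≤ e^{ε·#(Q ∩ Y)}` by the pinned entropy bound.

NOT CLAIMED: the specific lattice entropy constants (the consumer supplies `sz`, `ε`, `A₀`); anything analytic.  No `sorry`; no definitions;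
no named fact.

References: [Balaban1989LargeFieldII] T. Bałaban, CMP **122** (1989) 355–392, (1.97)–(1.100) pp. 389–390; [KoteckyPreiss1986] R. Kotecký,
D. Preiss, CMP **103** (1986) 491–498, Theorem p. 492 (4); [Dimock2013BalabanII] J. Dimock, J. Math. Phys. **54** (2013) 092301, App. F (sunshine).
-/

namespace Literature.MathematicalPhysics.QuantumFieldTheory.Balaban1983to89.B16RatioResummation

open Classical
open Finset
open Literature.Probability.LatticeModels
open Literature.MathematicalPhysics.QuantumFieldTheory.Balaban1983to89.B16Eq190Resummation

noncomputable section

variable {α : Type*} [DecidableEq α] [Fintype α]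

/-! ## Part I. The activity bound -/

section Bound

variable {adm : Finset α → Prop} {Λ : Finset (Finset α)} {Q : Finset α} {h v : Finset α → ℂ}
variable {sz : Finset α → ℝ} {sf : α → ℝ} {κh κ' τ A₀ ε : ℝ} {a d : Finset α → ℝ}

omit [Fintype α] in
/-- **(iv) The covering clause collects one small factor per marked point of `Y`.** [cite: Balaban1989LargeFieldII, (1.97) p.389] -/
theorem prod_prod_sf_le (hsf0 : ∀ b, 0 ≤ sf b) (hsf1 : ∀ b, sf b ≤ 1) {Y : Finset α} {S' : Finset (HItem α)}
    (hS : ∀ X ∈ S', X.1 ⊆ Y) (hcov : ∀ b ∈ Q ∩ Y, ∃ X ∈ S', b ∈ X.1) :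
    ∏ X ∈ S', ∏ b ∈ Q ∩ X.1, sf b ≤ ∏ b ∈ Q ∩ Y, sf b := by
  rw [Finset.prod_comm' (s' := fun b => S'.filter fun X => b ∈ X.1) (t' := Q ∩ Y) (by
    intro X b
    simp only [mem_inter, mem_filter]
    constructor
    · rintro ⟨hX, hbQ, hbX⟩; exact ⟨⟨hX, hbX⟩, hbQ, hS X hX hbX⟩
    · rintro ⟨⟨hX, hbX⟩, hbQ, -⟩; exact ⟨hX, hbQ, hbX⟩)]
  refine Finset.prod_le_prod (fun b _ => Finset.prod_nonneg fun _ _ => hsf0 b) fun b hb => ?_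
  rw [Finset.prod_const]
  refine pow_le_of_le_one (hsf0 b) (hsf1 b) (Finset.card_pos.2 ?_).ne'
  obtain ⟨X, hX, hbX⟩ := hcov b hb
  exact ⟨X, mem_filter.2 ⟨hX, hbX⟩⟩

omit [DecidableEq α] [Fintype α] in
/-- `Π (1 + x_i) ≤ exp(Σ x_i)` for `x_i ≥ 0`. [folklore] -/
private theorem prod_one_add_le_exp_sum {ι : Type*} (s : Finset ι) (x : ι → ℝ) (hx : ∀ i ∈ s, 0 ≤ x i) :
    ∏ i ∈ s, (1 + x i) ≤ Real.exp (∑ i ∈ s, x i) := by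
  rw [Real.exp_sum]
  exact Finset.prod_le_prod (fun i hi => by linarith [hx i hi]) fun i _ => by linarith [Real.add_one_le_exp (x i)]

omit [DecidableEq α] [Fintype α] in
/-- A constrained sum over finite families of a finite type is the product `Π (1 + ·)` over the allowed members. [folklore] -/
private theorem sum_ite_forall_prod_eq {ι : Type*} [Fintype ι] [DecidableEq ι] (P : ι → Prop) [DecidablePred P] (f : ι → ℝ) :
    ∑ D : Finset ι, (if ∀ i ∈ D, P i then ∏ i ∈ D, f i else 0) = ∏ i ∈ Finset.univ.filter P, (1 + f i) := by
  have hset : (Finset.univ : Finset (Finset ι)).filter (fun D => ∀ i ∈ D, P i) = (Finset.univ.filter P).powerset := by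
    ext D; simp only [mem_filter, mem_univ, true_and, mem_powerset, subset_iff]
  rw [← Finset.sum_filter, hset, Finset.prod_one_add]

/-- **(iii′) The sum over the attached cluster families of a hole family is at most `exp(e^{A₀}·Σ_X a(X))`.**
[cite: Balaban1989LargeFieldII, (1.97) p.389] -/
theorem sum_clusterFamilies_le (ha : ∀ γ, 0 ≤ a γ) (hd : ∀ γ, 0 ≤ d γ)
    (hKP : ∀ σ : Finset α, ∑ γ' ∈ Finset.univ.filter (fun γ' => polyInc γ' σ), ‖v γ'‖ * Real.exp (a γ' + d γ') ≤ a σ)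
    (hA₀ : ∀ γ ∈ Λ, a γ * Real.exp (-d γ) ≤ A₀) (hdγ : ∀ γ ∈ Λ, κ' * sz γ ≤ d γ) (S' : Finset (HItem α)) :
    ∑ D' : Finset (CItem α), (if ∀ C ∈ D', C.1 ⊆ Λ ∧ ∃ X ∈ S', KPTouches polyInc C.1 X.1
        then ∏ C ∈ D', ‖mayerU v C.1‖ * Real.exp (κ' * ∑ γ ∈ C.1, sz γ) else 0) ≤
      Real.exp (Real.exp A₀ * ∑ X ∈ S', a X.1) := by
  rw [sum_ite_forall_prod_eq]
  refine (prod_one_add_le_exp_sum _ _ fun C _ => mul_nonneg (norm_nonneg _) (Real.exp_nonneg _)).trans ?_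
  refine Real.exp_le_exp.2 ?_
  -- split the attached cluster items over the hole polymers they touch
  set g : CItem α → ℝ := fun C => ‖mayerU v C.1‖ * Real.exp (κ' * ∑ γ ∈ C.1, sz γ) with hg
  have hg0 : ∀ C, 0 ≤ g C := fun C => mul_nonneg (norm_nonneg _) (Real.exp_nonneg _)
  have hsub : (Finset.univ.filter fun C : CItem α => C.1 ⊆ Λ ∧ ∃ X ∈ S', KPTouches polyInc C.1 X.1) ⊆
      S'.biUnion fun X => Finset.univ.filter fun C : CItem α => C.1 ⊆ Λ ∧ KPTouches polyInc C.1 X.1 := by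
    intro C hC
    obtain ⟨hCΛ, X, hX, ht⟩ := (mem_filter.1 hC).2
    exact mem_biUnion.2 ⟨X, hX, mem_filter.2 ⟨mem_univ _, hCΛ, ht⟩⟩
  refine (Finset.sum_le_sum_of_subset_of_nonneg hsub fun C _ _ => hg0 C).trans ?_
  refine (sum_biUnion_le_sum_of_nonneg S' _ g hg0).trans ?_
  rw [Finset.mul_sum]
  refine Finset.sum_le_sum fun X _ => ?_
  -- one hole polymer: lift the cluster items to clusters of `Λ` and apply (iii)
  have hmap : ∑ C ∈ Finset.univ.filter (fun C : CItem α => C.1 ⊆ Λ ∧ KPTouches polyInc C.1 X.1), g C =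
      ∑ C ∈ (Finset.univ.filter (fun C : CItem α => C.1 ⊆ Λ ∧ KPTouches polyInc C.1 X.1)).map (Function.Embedding.subtype _),
        ‖mayerU v C‖ * Real.exp (κ' * ∑ γ ∈ C, sz γ) := by
    rw [Finset.sum_map]; rfl
  rw [hmap]
  refine le_trans (Finset.sum_le_sum_of_subset_of_nonneg (fun C hC => ?_) fun C _ _ => mul_nonneg (norm_nonneg _) (Real.exp_nonneg _))
    (sum_mayer_touch_le ha hd hKP hA₀ hdγ X.1)
  obtain ⟨C', hC', rfl⟩ := mem_map.1 hC
  obtain ⟨hCΛ, ht⟩ := (mem_filter.1 hC').2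
  exact mem_filter.2 ⟨mem_powerset.2 hCΛ, ht⟩

/-- **(v) The sum over admissible hole families inside `Y`, weighted by `e^{−κ″ sz}`, is at most `e^{ε·#(Q ∩ Y)}`.**
[cite: Balaban1989LargeFieldII, (1.97) p.389] -/
theorem sum_holeFamilies_le {κ'' : ℝ} (hadmQ : ∀ X, adm X → (Q ∩ X).Nonempty)
    (hent : ∀ b ∈ Q, ∑ X ∈ Finset.univ.filter (fun X : Finset α => adm X ∧ b ∈ X), Real.exp (-(κ'' * sz X)) ≤ ε) (Y : Finset α) :
    ∑ S' : Finset (HItem α), (if ∀ X ∈ S', adm X.1 ∧ X.1 ⊆ Y then ∏ X ∈ S', Real.exp (-(κ'' * sz X.1)) else 0) ≤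
      Real.exp (ε * ((Q ∩ Y).card : ℝ)) := by
  rw [sum_ite_forall_prod_eq]
  refine (prod_one_add_le_exp_sum _ _ fun X _ => (Real.exp_nonneg _)).trans (Real.exp_le_exp.2 ?_)
  -- every admissible hole polymer inside `Y` contains a marked point of `Y`
  have hsub : (Finset.univ.filter fun X : HItem α => adm X.1 ∧ X.1 ⊆ Y) ⊆
      (Q ∩ Y).biUnion fun b => Finset.univ.filter fun X : HItem α => adm X.1 ∧ b ∈ X.1 := by
    intro X hX
    obtain ⟨hadmX, hXY⟩ := (mem_filter.1 hX).2
    obtain ⟨b, hb⟩ := hadmQ X.1 hadmX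
    obtain ⟨hbQ, hbX⟩ := mem_inter.1 hb
    exact mem_biUnion.2 ⟨b, mem_inter.2 ⟨hbQ, hXY hbX⟩, mem_filter.2 ⟨mem_univ _, hadmX, hbX⟩⟩
  refine (Finset.sum_le_sum_of_subset_of_nonneg hsub fun X _ _ => Real.exp_nonneg _).trans ?_
  refine (sum_biUnion_le_sum_of_nonneg (Q ∩ Y) _ _ fun X => Real.exp_nonneg _).trans ?_
  have hb : ∀ b ∈ Q ∩ Y, ∑ X ∈ Finset.univ.filter (fun X : HItem α => adm X.1 ∧ b ∈ X.1), Real.exp (-(κ'' * sz X.1)) ≤ ε := by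
    intro b hb
    have hmap : ∑ X ∈ Finset.univ.filter (fun X : HItem α => adm X.1 ∧ b ∈ X.1), Real.exp (-(κ'' * sz X.1)) =
        ∑ X ∈ (Finset.univ.filter (fun X : HItem α => adm X.1 ∧ b ∈ X.1)).map (Function.Embedding.subtype _),
          Real.exp (-(κ'' * sz X)) := by
      rw [Finset.sum_map]; rfl
    rw [hmap]
    refine le_trans (Finset.sum_le_sum_of_subset_of_nonneg (fun X hX => ?_) fun X _ _ => Real.exp_nonneg _)
      (hent b (mem_inter.1 hb).1)
    obtain ⟨X', hX', rfl⟩ := mem_map.1 hX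
    exact mem_filter.2 ⟨mem_univ _, (mem_filter.1 hX').2⟩
  calc ∑ b ∈ Q ∩ Y, ∑ X ∈ Finset.univ.filter (fun X : HItem α => adm X.1 ∧ b ∈ X.1), Real.exp (-(κ'' * sz X.1))
      ≤ ∑ b ∈ Q ∩ Y, ε := Finset.sum_le_sum hb
    _ = ε * ((Q ∩ Y).card : ℝ) := by rw [Finset.sum_const, nsmul_eq_mul, mul_comm]

omit [Fintype α] in
/-- **(i′) The per-term bound**: a covered term with footprint `Y` is at most `e^{−κ′ sz Y}` times the product of its items' sizes
reweighted by `e^{κ′ sz}`. [cite: Balaban1989LargeFieldII, (1.97) p.389] -/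
theorem norm_termWCov_le (hsze : sz ∅ = 0) (hsz : ∀ A B, sz (A ∪ B) ≤ sz A + sz B) (hκ' : 0 ≤ κ') {Y : Finset α}
    {T : Finset (Item α)} (hT : fp loc T = Y) :
    ‖termWCov adm Λ Q h v T‖ ≤ Real.exp (-(κ' * sz Y)) *
      (if LocCov Q T ∧ TermOk adm Λ T then
        (∏ X ∈ T.toLeft, ‖h X.1‖ * Real.exp (κ' * sz X.1)) *
          ∏ C ∈ T.toRight, ‖mayerU v C.1‖ * Real.exp (κ' * ∑ γ ∈ C.1, sz γ) else 0) := by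
  unfold termWCov termW
  by_cases hcov : LocCov Q T
  · by_cases hok : TermOk adm Λ T
    · rw [if_pos hcov, if_pos hok, if_pos ⟨hcov, hok⟩, norm_mul, norm_prod, norm_prod]
      have hszY : κ' * sz Y ≤ κ' * (∑ X ∈ T.toLeft, sz X.1 + ∑ C ∈ T.toRight, ∑ γ ∈ C.1, sz γ) :=
        mul_le_mul_of_nonneg_left (hT ▸ sz_fp_le hsze hsz T) hκ'
      have hexp : (1 : ℝ) ≤ Real.exp (-(κ' * sz Y)) *
          ((∏ X ∈ T.toLeft, Real.exp (κ' * sz X.1)) * ∏ C ∈ T.toRight, Real.exp (κ' * ∑ γ ∈ C.1, sz γ)) := by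
        rw [← Real.exp_sum, ← Real.exp_sum, ← Real.exp_add, ← Real.exp_add, ← Finset.mul_sum, ← Finset.mul_sum]
        exact Real.one_le_exp (by nlinarith)
      have hnn : 0 ≤ (∏ X ∈ T.toLeft, ‖h X.1‖) * ∏ C ∈ T.toRight, ‖mayerU v C.1‖ :=
        mul_nonneg (Finset.prod_nonneg fun _ _ => norm_nonneg _) (Finset.prod_nonneg fun _ _ => norm_nonneg _)
      calc (∏ X ∈ T.toLeft, ‖h X.1‖) * ∏ C ∈ T.toRight, ‖mayerU v C.1‖
          ≤ ((∏ X ∈ T.toLeft, ‖h X.1‖) * ∏ C ∈ T.toRight, ‖mayerU v C.1‖) * (Real.exp (-(κ' * sz Y)) *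
              ((∏ X ∈ T.toLeft, Real.exp (κ' * sz X.1)) * ∏ C ∈ T.toRight, Real.exp (κ' * ∑ γ ∈ C.1, sz γ))) :=
            le_mul_of_one_le_right hnn hexp
        _ = Real.exp (-(κ' * sz Y)) * ((∏ X ∈ T.toLeft, ‖h X.1‖ * Real.exp (κ' * sz X.1)) *
              ∏ C ∈ T.toRight, ‖mayerU v C.1‖ * Real.exp (κ' * ∑ γ ∈ C.1, sz γ)) := by
            rw [Finset.prod_mul_distrib, Finset.prod_mul_distrib]; ring
    · rw [if_pos hcov, if_neg hok, if_neg (fun H => hok H.2), norm_zero, mul_zero]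
  · rw [if_neg hcov, if_neg (fun H => hcov H.1), norm_zero, mul_zero]

/-- **THE ACTIVITY BOUND ((1.97)-type ∕ Dimock's (sunshine))**: one small factor per covered marked point, exponential decay in the size of
the footprint: `‖holeAct adm Λ Q h v Y‖ ≤ (Π_{b ∈ Q ∩ Y} sf b·e^{ε})·e^{−κ′·sz Y}`.
[cite: Balaban1989LargeFieldII, (1.97) p.389] -/
theorem norm_holeAct_le (hsze : sz ∅ = 0) (hsz : ∀ A B, sz (A ∪ B) ≤ sz A + sz B) (hκ' : 0 ≤ κ')
    (hsf0 : ∀ b, 0 ≤ sf b) (hsf1 : ∀ b, sf b ≤ 1) (hadmQ : ∀ X, adm X → (Q ∩ X).Nonempty)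
    (hh : ∀ X, adm X → ‖h X‖ ≤ (∏ b ∈ Q ∩ X, sf b) * Real.exp (-(κh * sz X)))
    (ha : ∀ γ, 0 ≤ a γ) (hd : ∀ γ, 0 ≤ d γ)
    (hKP : ∀ σ : Finset α, ∑ γ' ∈ Finset.univ.filter (fun γ' => polyInc γ' σ), ‖v γ'‖ * Real.exp (a γ' + d γ') ≤ a σ)
    (haX : ∀ X, adm X → a X ≤ τ * sz X) (hdγ : ∀ γ ∈ Λ, κ' * sz γ ≤ d γ) (hA₀ : ∀ γ ∈ Λ, a γ * Real.exp (-d γ) ≤ A₀)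
    (hent : ∀ b ∈ Q, ∑ X ∈ Finset.univ.filter (fun X : Finset α => adm X ∧ b ∈ X),
      Real.exp (-((κh - κ' - Real.exp A₀ * τ) * sz X)) ≤ ε)
    (Y : Finset α) :
    ‖holeAct adm Λ Q h v Y‖ ≤ (∏ b ∈ Q ∩ Y, sf b * Real.exp ε) * Real.exp (-(κ' * sz Y)) := by
  -- abbreviations
  set H : HItem α → ℝ := fun X => ‖h X.1‖ * Real.exp (κ' * sz X.1) with hH
  set U : CItem α → ℝ := fun C => ‖mayerU v C.1‖ * Real.exp (κ' * ∑ γ ∈ C.1, sz γ) with hU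
  have hH0 : ∀ X, 0 ≤ H X := fun X => mul_nonneg (norm_nonneg _) (Real.exp_nonneg _)
  have hU0 : ∀ C, 0 ≤ U C := fun C => mul_nonneg (norm_nonneg _) (Real.exp_nonneg _)
  -- the relaxed weight on all item families
  set G : Finset (Item α) → ℝ := fun T =>
    if ((∀ X ∈ T.toLeft, adm X.1 ∧ X.1 ⊆ Y) ∧ (∀ b ∈ Q ∩ Y, ∃ X ∈ T.toLeft, b ∈ X.1) ∧
        ∀ C ∈ T.toRight, C.1 ⊆ Λ ∧ ∃ X ∈ T.toLeft, KPTouches polyInc C.1 X.1)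
    then (∏ X ∈ T.toLeft, H X) * ∏ C ∈ T.toRight, U C else 0 with hG
  have hG0 : ∀ T, 0 ≤ G T := fun T => by
    simp only [hG]; split_ifs
    · exact mul_nonneg (Finset.prod_nonneg fun X _ => hH0 X) (Finset.prod_nonneg fun C _ => hU0 C)
    · exact le_rfl
  -- Step 1–2: per-term bound and relaxation of the index set
  have step12 : ‖holeAct adm Λ Q h v Y‖ ≤ Real.exp (-(κ' * sz Y)) * ∑ T : Finset (Item α), G T := by
    unfold holeAct F
    refine (norm_sum_le _ _).trans ?_
    rw [Finset.mul_sum]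
    refine le_trans (Finset.sum_le_sum fun T hT => ?_)
      (Finset.sum_le_sum_of_subset_of_nonneg (Finset.subset_univ _) fun T _ _ => mul_nonneg (Real.exp_nonneg _) (hG0 T))
    obtain ⟨-, hfp⟩ := mem_fibC.1 hT
    refine (norm_termWCov_le (adm := adm) (Λ := Λ) (Q := Q) (h := h) (v := v) hsze hsz hκ' hfp).trans
      (mul_le_mul_of_nonneg_left ?_ (Real.exp_nonneg _))
    by_cases hc : LocCov Q T ∧ TermOk adm Λ T
    · rw [if_pos hc]
      have hc' : (∀ X ∈ T.toLeft, adm X.1 ∧ X.1 ⊆ Y) ∧ (∀ b ∈ Q ∩ Y, ∃ X ∈ T.toLeft, b ∈ X.1) ∧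
          ∀ C ∈ T.toRight, C.1 ⊆ Λ ∧ ∃ X ∈ T.toLeft, KPTouches polyInc C.1 X.1 := by
        refine ⟨fun X hX => ⟨hc.2.1 X hX, hfp ▸ subset_fp_of_mem_toLeft hX⟩, fun b hb => ?_, fun C hC => ?_⟩
        · obtain ⟨hbQ, hbY⟩ := mem_inter.1 hb
          exact hc.1 b hbQ (hfp ▸ hbY)
        · obtain ⟨hCΛ, -, X, hX, γ, hγ, hγX⟩ := hc.2.2.2 C hC
          exact ⟨hCΛ, X, hX, γ, hγ, hγX⟩
      simp only [hG, if_pos hc']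
      exact le_rfl
    · rw [if_neg hc]; exact hG0 T
  -- Step 3: item families = (hole items, cluster items); the cluster sums
  have step3 : ∑ T : Finset (Item α), G T ≤
      ∑ S' : Finset (HItem α), (if (∀ X ∈ S', adm X.1 ∧ X.1 ⊆ Y) ∧ (∀ b ∈ Q ∩ Y, ∃ X ∈ S', b ∈ X.1)
        then (∏ X ∈ S', H X) * Real.exp (Real.exp A₀ * ∑ X ∈ S', a X.1) else 0) := by
    rw [Fintype.sum_equiv Finset.sumEquiv.toEquiv _ (fun p : Finset (HItem α) × Finset (CItem α) => G (p.1.disjSum p.2))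
        (fun T => by
          change _ = G ((Finset.sumEquiv T).1.disjSum (Finset.sumEquiv T).2)
          rw [Finset.sumEquiv_apply_fst, Finset.sumEquiv_apply_snd, toLeft_disjSum_toRight]),
      Fintype.sum_prod_type]
    refine Finset.sum_le_sum fun S' _ => ?_
    simp only [hG, toLeft_disjSum, toRight_disjSum]
    by_cases hS : (∀ X ∈ S', adm X.1 ∧ X.1 ⊆ Y) ∧ (∀ b ∈ Q ∩ Y, ∃ X ∈ S', b ∈ X.1)
    · rw [if_pos hS]
      have hrw : ∀ D' : Finset (CItem α),
          (if (∀ X ∈ S', adm X.1 ∧ X.1 ⊆ Y) ∧ (∀ b ∈ Q ∩ Y, ∃ X ∈ S', b ∈ X.1) ∧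
              ∀ C ∈ D', C.1 ⊆ Λ ∧ ∃ X ∈ S', KPTouches polyInc C.1 X.1
            then (∏ X ∈ S', H X) * ∏ C ∈ D', U C else 0) =
          (∏ X ∈ S', H X) * (if ∀ C ∈ D', C.1 ⊆ Λ ∧ ∃ X ∈ S', KPTouches polyInc C.1 X.1 then ∏ C ∈ D', U C else 0) := by
        intro D'
        by_cases hD : ∀ C ∈ D', C.1 ⊆ Λ ∧ ∃ X ∈ S', KPTouches polyInc C.1 X.1
        · rw [if_pos ⟨hS.1, hS.2, hD⟩, if_pos hD]
        · rw [if_neg (fun H' => hD H'.2.2), if_neg hD, mul_zero]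
      simp only [hrw, ← Finset.mul_sum]
      exact mul_le_mul_of_nonneg_left (sum_clusterFamilies_le ha hd hKP hA₀ hdγ S') (Finset.prod_nonneg fun X _ => hH0 X)
    · rw [if_neg hS]
      refine Finset.sum_nonpos fun D' _ => ?_
      rw [if_neg (fun H' => hS ⟨H'.1, H'.2.1⟩)]
  -- Step 4: the hole activities, one small factor per marked point
  have step4 : ∑ S' : Finset (HItem α), (if (∀ X ∈ S', adm X.1 ∧ X.1 ⊆ Y) ∧ (∀ b ∈ Q ∩ Y, ∃ X ∈ S', b ∈ X.1)
        then (∏ X ∈ S', H X) * Real.exp (Real.exp A₀ * ∑ X ∈ S', a X.1) else 0) ≤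
      (∏ b ∈ Q ∩ Y, sf b) * ∑ S' : Finset (HItem α),
        (if ∀ X ∈ S', adm X.1 ∧ X.1 ⊆ Y then ∏ X ∈ S', Real.exp (-((κh - κ' - Real.exp A₀ * τ) * sz X.1)) else 0) := by
    rw [Finset.mul_sum]
    refine Finset.sum_le_sum fun S' _ => ?_
    by_cases hS : (∀ X ∈ S', adm X.1 ∧ X.1 ⊆ Y) ∧ (∀ b ∈ Q ∩ Y, ∃ X ∈ S', b ∈ X.1)
    · rw [if_pos hS, if_pos hS.1, Finset.mul_sum, Real.exp_sum, ← Finset.prod_mul_distrib]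
      -- termwise: `H X · e^{e^{A₀} a X} ≤ (Π sf) · e^{−κ″ sz X}`
      have hterm : ∀ X ∈ S', H X * Real.exp (Real.exp A₀ * a X.1) ≤
          (∏ b ∈ Q ∩ X.1, sf b) * Real.exp (-((κh - κ' - Real.exp A₀ * τ) * sz X.1)) := by
        intro X hX
        have hadmX := (hS.1 X hX).1
        have h1 := hh X.1 hadmX
        have h2 : Real.exp A₀ * a X.1 ≤ Real.exp A₀ * (τ * sz X.1) := mul_le_mul_of_nonneg_left (haX X.1 hadmX) (Real.exp_nonneg _)
        have hsf : 0 ≤ ∏ b ∈ Q ∩ X.1, sf b := Finset.prod_nonneg fun b _ => hsf0 b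
        calc H X * Real.exp (Real.exp A₀ * a X.1)
            ≤ ((∏ b ∈ Q ∩ X.1, sf b) * Real.exp (-(κh * sz X.1))) * Real.exp (κ' * sz X.1) * Real.exp (Real.exp A₀ * (τ * sz X.1)) := by
              refine mul_le_mul (mul_le_mul_of_nonneg_right h1 (Real.exp_nonneg _)) (Real.exp_le_exp.2 h2) (Real.exp_nonneg _) ?_
              exact mul_nonneg (mul_nonneg hsf (Real.exp_nonneg _)) (Real.exp_nonneg _)
          _ = (∏ b ∈ Q ∩ X.1, sf b) * Real.exp (-((κh - κ' - Real.exp A₀ * τ) * sz X.1)) := by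
              rw [mul_assoc, mul_assoc, ← Real.exp_add, ← Real.exp_add]; congr 2; ring
      calc ∏ X ∈ S', H X * Real.exp (Real.exp A₀ * a X.1)
          ≤ ∏ X ∈ S', (∏ b ∈ Q ∩ X.1, sf b) * Real.exp (-((κh - κ' - Real.exp A₀ * τ) * sz X.1)) :=
            Finset.prod_le_prod (fun X _ => mul_nonneg (hH0 X) (Real.exp_nonneg _)) hterm
        _ = (∏ X ∈ S', ∏ b ∈ Q ∩ X.1, sf b) * ∏ X ∈ S', Real.exp (-((κh - κ' - Real.exp A₀ * τ) * sz X.1)) :=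
            Finset.prod_mul_distrib
        _ ≤ (∏ b ∈ Q ∩ Y, sf b) * ∏ X ∈ S', Real.exp (-((κh - κ' - Real.exp A₀ * τ) * sz X.1)) :=
            mul_le_mul_of_nonneg_right (prod_prod_sf_le hsf0 hsf1 (fun X hX => (hS.1 X hX).2) hS.2)
              (Finset.prod_nonneg fun _ _ => Real.exp_nonneg _)
    · rw [if_neg hS]
      split_ifs
      · exact mul_nonneg (Finset.prod_nonneg fun b _ => hsf0 b) (Finset.prod_nonneg fun _ _ => Real.exp_nonneg _)
      · exact le_of_eq (mul_zero _).symm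
  -- Step 5: the entropy of admissible hole polymers inside `Y`
  have step5 := sum_holeFamilies_le (adm := adm) (sz := sz) (ε := ε) (κ'' := κh - κ' - Real.exp A₀ * τ) hadmQ hent Y
  have hsfY : 0 ≤ ∏ b ∈ Q ∩ Y, sf b := Finset.prod_nonneg fun b _ => hsf0 b
  calc ‖holeAct adm Λ Q h v Y‖
      ≤ Real.exp (-(κ' * sz Y)) * ((∏ b ∈ Q ∩ Y, sf b) * Real.exp (ε * ((Q ∩ Y).card : ℝ))) :=
        step12.trans (mul_le_mul_of_nonneg_left (step3.trans (step4.trans (mul_le_mul_of_nonneg_left step5 hsfY))) (Real.exp_nonneg _))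
    _ = (∏ b ∈ Q ∩ Y, sf b * Real.exp ε) * Real.exp (-(κ' * sz Y)) := by
        rw [Finset.prod_mul_distrib, Finset.prod_const, ← Real.exp_nat_mul, mul_comm ((Q ∩ Y).card : ℝ) ε]; ring

end Bound

end

end Literature.MathematicalPhysics.QuantumFieldTheory.Balaban1983to89.B16RatioResummation
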